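/-
Copyright: the b2b-balaban T⁴-continuum CRUX team, row NE7b leaf lineage `t4-ne7b-formalise-leaf-05` (gen 156). Project licence.
-/
import Summits.QuantumFields.BalabanUV.T4Continuum.Spine.NE7b.NonAbelianStokesTransposition

/-!
# (NAS) part 5 — TWO LATTICE PATHS WITH THE SAME LETTERS: the loop «out along `P`, back along `Q`» (`Q` a permutation of `P`) is BUILT by a
# script of `NonAbelianStokesDisc` — a backtrack tower for `Q Q⁻¹`, then a bubble sort of `Q` into `P` by the transposition scripts of part 4 —
# gluing only non-degenerate plaquettes, at most `|P|·|Q|` of them (at most `L·|Γ|` for `Γ S` against `S Γ`, `S` a straight segment of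
# length `L`); hence `dist1 (U(P) U(Q)⁻¹) ≤ #plaquettes · ε` under a plaquette letter `ε` (row NE7b, node U5c; Lemma CS (ii) of
# `HOME/b2b-balaban-r1/SectE-interface-proof.md` — «the two transports connect the same endpoints by fine paths … enclosing O(d) unit squares» —
# for the cell's pair «tree contour then segment» vs «segment then translated tree contour», `treeWord r ++ seg κ L` vs `seg κ L ++ treeWord r`)

Cell `pub-balaban`, sub-cell `t4`, spine estimate NE7b (`T4WeightBudget.RelWeightBound`; the cell's OWN estimate — NOT PRINTED in [Bałaban 1983–89],
NOT PROVED).  Crux-route work under `Spine/NE7b/` by a row leaf; [folklore] list bookkeeping + leaf-01's (NAS) for built words BY NAME; NOTHING of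
Bałaban's is named, asserted or valued; no `T4Continuum/Support` leaf typed; FOUR data definitions (scripts `toFront`, `sortMoves`, `towerMoves`,
`pathPairScript` — list-valued, no `Prop`-valued definition); zero `sorry`.  Imports this lineage's `NonAbelianStokesTransposition` ONLY (`swapMoves`,
`build_swapMoves_append`, `loops_swapMoves_append`; through it `NonAbelianStokesDisc.dist1_hol_build_le_sum` and `B7Prop1Explicit`'s words:
`revWord`, `hol_append`, `hol_revWord`, `treeWord`, `seg`, `l1`).

WHAT IS PROVED ([folklore]; `X`, `Z` arbitrary context words, `|X| = n`, `rest` any script with the displayed `build rest`):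
* §0 `map_snd_glued` (`(glued x ms).map Prod.snd = loops ms` — glued words are the inserted words; their numbers agree).
* §1 `toFront l n Q` — bring the first occurrence of `l` in `Q` to the front by adjacent transpositions: **`build_toFront_append`**
  (`X ++ Q ++ Z ↦ X ++ l :: Q.erase l ++ Z` for `l ∈ Q`), `mem_loops_toFront_append` (new inserted words are `plaqWord a b`, `a ≠ b`),
  `length_loops_toFront_append_le` (`≤ |Q|` new plaquettes), `length_loops_toFront_append_le_of_eq` (`Q = A ++ l :: B` ⟹ `≤ |A|`).
* §2 `sortMoves n P Q` — bubble sort of `Q` into `P`: **`build_sortMoves_append`** (`Q ~ P` ⟹ `X ++ Q ++ Z ↦ X ++ P ++ Z`), `mem_loops_sortMoves_append`,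
  **`length_loops_sortMoves_append_le`** (`≤ |P|·|Q|`); the commuting instance **`length_loops_sortMoves_comm_replicate_le`**
  (`P = Γ ++ S`, `Q = S ++ Γ`, `S = replicate L c` ⟹ `≤ L·|Γ|`).
* §3 `towerMoves n Q` (the backtrack tower: `X ++ Z ↦ X ++ Q ++ Q⁻¹ ++ Z`, no plaquette) and **`pathPairScript P Q`**: **`build_pathPairScript`**
  (`Q ~ P` ⟹ `build = P ++ revWord Q`), `exists_eq_plaqWord_of_mem_loops_pathPairScript`, `length_loops_pathPairScript_le` (`≤ |P|·|Q|`),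
  `length_loops_pathPairScript_comm_replicate_le` (`≤ L·|Γ|`).
* §4 (NAS) [`GaugeGroup G`]: **`dist1_hol_mul_inv_le_sum`** (`Q ~ P` ⟹ `dist1 (U(P; x) U(Q; x)⁻¹) ≤ Σ_{glued} dist1 U(∂p)`),
  **`dist1_hol_mul_inv_le_of_plaquette_letter`** (`… ≤ |P|·|Q|·ε` if every non-degenerate plaquette holonomy has `dist1 ≤ ε`, `ε ≥ 0`),
  **`dist1_hol_comm_replicate_le`** (`dist1 (U(Γ S) U(S Γ)⁻¹) ≤ L·|Γ|·ε`) and the cell's pair **`dist1_hol_treeWord_seg_comm_le`**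
  (`dist1 (U(treeWord r ++ seg κ L) U(seg κ L ++ treeWord r)⁻¹) ≤ L·l1(r)·ε` — tree contour then segment vs segment then translated contour).
* §5 toys.

NOT HERE (honest): WHERE the glued plaquettes lie and with what multiplicity across the family of block pairs ((5.2)'s counting is
`CovariantStokesCounting`; locating the corners is (A3) bookkeeping — the corner of each transposition is named in part 4); the linearised reading;
the values of `ε_F`, `c_g`; which paths are Bałaban's ((A3) ∕ (A1c), NC-NE7b-α UNRULED).  BY-NAME EFFECT ON THE WALL: NONE.  NE7b NOT PRINTED ∕
NOT PROVED; spine PROVED 0∕9; rung (B)+1 on a FINITE torus — NOT infinite volume, NOT the mass gap, NOT Clay.  HONEST DEPENDENCY: continuum YM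
on T⁴ ⇐ BetaPertH ∧ nine spine estimates (0/9 proved); BetaPertH ⇐ (D1) ∧ (D4) ∧ CAP+tail; G-an2-4 gates asym, D1 and NE2/3/4.
-/

set_option autoImplicit false

namespace Summit.QuantumFields.BalabanUV.T4Continuum.NE7b.NonAbelianStokesPathPair

open Literature.MathematicalPhysics.QuantumFieldTheory.Balaban1983to89 (GaugeGroup dist1)
open Literature.MathematicalPhysics.QuantumFieldTheory.Balaban1983to89.B7Prop1Explicit
  (Site Letter e disp disp_append hol hol_append hol_revWord revWord revWord_cons plaqWord disp_plaqWord seg seg_natCast treeWord l1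
   length_treeWord)
open NonAbelianStokesDisc
open NonAbelianStokesTransposition (build_backtrack_of_eq swapMoves build_swapMoves_append loops_swapMoves_append)

variable {d : ℕ}

/-! ## §0 Glued words are the inserted words -/

/-- The glued loops of a script, with their base points forgotten, are its inserted words (so the two lists have the same length). [folklore] -/
theorem map_snd_glued (x : Site d) : ∀ ms : List (Move d), (glued x ms).map Prod.snd = loops ms
  | [] => rfl
  | Move.backtrack _ _ :: ms => by rw [glued, loops, map_snd_glued x ms]
  | Move.cancel _ _ :: ms => by rw [glued, loops, map_snd_glued x ms]
  | Move.loop _ _ :: ms => by rw [glued, loops, List.map_cons, map_snd_glued x ms]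

/-! ## §1 Bringing a letter to the front -/

section ToFront

/-- DATA.  `toFront l n Q`: transpose the first occurrence of `l` in `Q` (the word sitting after a prefix of length `n`) step by step to the
front of `Q` (head applied last: the deepest transposition first). -/
def toFront (l : Letter d) : ℕ → List (Letter d) → List (Move d)
  | _, [] => []
  | n, q :: Q => if q = l then [] else swapMoves q l n ++ toFront l (n + 1) Q

/-- **`toFront` MOVES THE LETTER TO THE FRONT**: `build rest = X ++ Q ++ Z`, `|X| = n`, `l ∈ Q` ⟹
`build (toFront l n Q ++ rest) = X ++ l :: (Q.erase l ++ Z)`. [folklore] -/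
theorem build_toFront_append (l : Letter d) : ∀ (Q X Z : List (Letter d)) {n : ℕ}, X.length = n → ∀ rest : List (Move d),
    build rest = X ++ Q ++ Z → l ∈ Q → build (toFront l n Q ++ rest) = X ++ l :: (Q.erase l ++ Z)
  | [], _, _, _, _, _, _, hl => by simp at hl
  | q :: Q, X, Z, n, hX, rest, hrest, hl => by
    by_cases hq : q = l
    · subst hq
      rw [toFront, if_pos rfl, List.nil_append, hrest, List.erase_cons_head, List.append_assoc, List.cons_append]
    · have hl' : l ∈ Q := (List.mem_cons.mp hl).resolve_left (Ne.symm hq)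
      have ih := build_toFront_append l Q (X ++ [q]) Z (n := n + 1) (by simp [hX]) rest (by rw [hrest]; simp) hl'
      rw [toFront, if_neg hq, List.append_assoc, List.erase_cons_tail (by simpa using hq),
        build_swapMoves_append q l X (Q.erase l ++ Z) hX _ (by rw [ih]; simp)]
      rfl

/-- Every word inserted by `toFront` is a non-degenerate plaquette contour (or was inserted by `rest`). [folklore] -/
theorem mem_loops_toFront_append (l : Letter d) : ∀ (Q : List (Letter d)) (n : ℕ) (rest : List (Move d)) {σ : List (Letter d)},
    σ ∈ loops (toFront l n Q ++ rest) → σ ∈ loops rest ∨ ∃ a b : Fin d, a ≠ b ∧ σ = plaqWord a b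
  | [], _, _, _, hσ => Or.inl (by simpa [toFront] using hσ)
  | q :: Q, n, rest, σ, hσ => by
    rw [toFront] at hσ
    split_ifs at hσ with hq
    · exact Or.inl (by simpa using hσ)
    · rw [List.append_assoc] at hσ
      rcases NonAbelianStokesTransposition.exists_eq_plaqWord_of_mem_loops_swapMoves_append q l n _ hσ with h | h
      · exact mem_loops_toFront_append l Q (n + 1) rest h
      · exact Or.inr h

/-- `toFront` inserts at most `|Q|` plaquettes … -/
theorem length_loops_toFront_append_le (l : Letter d) : ∀ (Q : List (Letter d)) (n : ℕ) (rest : List (Move d)),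
    (loops (toFront l n Q ++ rest)).length ≤ (loops rest).length + Q.length
  | [], _, _ => by simp [toFront]
  | q :: Q, n, rest => by
    rw [toFront]
    split_ifs with hq
    · simp
    · have ih := length_loops_toFront_append_le l Q (n + 1) rest
      rw [List.append_assoc, loops_swapMoves_append, List.length_append, List.length_cons]
      split_ifs <;> simp <;> omega

/-- … more precisely at most as many as there are letters BEFORE an occurrence of `l`: `Q = A ++ l :: B` ⟹ `≤ |A|`. [folklore] -/
theorem length_loops_toFront_append_le_of_eq (l : Letter d) : ∀ (A B : List (Letter d)) (n : ℕ) (rest : List (Move d)),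
    (loops (toFront l n (A ++ l :: B) ++ rest)).length ≤ (loops rest).length + A.length
  | [], B, n, rest => by simp [toFront]
  | a :: A, B, n, rest => by
    rw [List.cons_append, toFront]
    split_ifs with ha
    · simp
    · have ih := length_loops_toFront_append_le_of_eq l A B (n + 1) rest
      rw [List.append_assoc, loops_swapMoves_append, List.length_append, List.length_cons]
      split_ifs <;> simp <;> omega

end ToFront

/-! ## §2 Sorting one word into another -/

section Sorting

/-- DATA.  `sortMoves n P Q`: turn the word `Q` (after a prefix of length `n`) into its permutation `P`, letter by letter — bring `P`'s head to
the front of `Q`, then sort the rest one position further on. -/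
def sortMoves : ℕ → List (Letter d) → List (Letter d) → List (Move d)
  | _, [], _ => []
  | n, p :: P, Q => sortMoves (n + 1) P (Q.erase p) ++ toFront p n Q

/-- **`sortMoves` SORTS**: `build rest = X ++ Q ++ Z`, `|X| = n`, `Q ~ P` ⟹ `build (sortMoves n P Q ++ rest) = X ++ P ++ Z`. [folklore] -/
theorem build_sortMoves_append : ∀ (P Q X Z : List (Letter d)) {n : ℕ}, X.length = n → ∀ rest : List (Move d),
    build rest = X ++ Q ++ Z → Q.Perm P → build (sortMoves n P Q ++ rest) = X ++ P ++ Z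
  | [], Q, X, Z, _, _, rest, hrest, hperm => by rw [sortMoves, List.nil_append, hrest, hperm.eq_nil]
  | p :: P, Q, X, Z, n, hX, rest, hrest, hperm => by
    have hp : p ∈ Q := hperm.mem_iff.mpr List.mem_cons_self
    have h1 := build_toFront_append p Q X Z hX rest hrest hp
    have hperm' : (Q.erase p).Perm P := ((List.perm_cons_erase hp).symm.trans hperm).cons_inv
    have ih := build_sortMoves_append P (Q.erase p) (X ++ [p]) Z (n := n + 1) (by simp [hX]) _ (by rw [h1]; simp) hperm'
    rw [sortMoves, List.append_assoc, ih]
    simp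

/-- Every word inserted by `sortMoves` is a non-degenerate plaquette contour (or was inserted by `rest`). [folklore] -/
theorem mem_loops_sortMoves_append : ∀ (P Q : List (Letter d)) (n : ℕ) (rest : List (Move d)) {σ : List (Letter d)},
    σ ∈ loops (sortMoves n P Q ++ rest) → σ ∈ loops rest ∨ ∃ a b : Fin d, a ≠ b ∧ σ = plaqWord a b
  | [], _, _, _, _, hσ => Or.inl (by simpa [sortMoves] using hσ)
  | p :: P, Q, n, rest, σ, hσ => by
    rw [sortMoves, List.append_assoc] at hσ
    rcases mem_loops_sortMoves_append P (Q.erase p) (n + 1) _ hσ with h | h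
    · exact mem_loops_toFront_append p Q n rest h
    · exact Or.inr h

/-- **`sortMoves` INSERTS AT MOST `|P|·|Q|` PLAQUETTES** (no permutation hypothesis needed). [folklore] -/
theorem length_loops_sortMoves_append_le : ∀ (P Q : List (Letter d)) (n : ℕ) (rest : List (Move d)),
    (loops (sortMoves n P Q ++ rest)).length ≤ (loops rest).length + P.length * Q.length
  | [], _, _, _ => by simp [sortMoves]
  | p :: P, Q, n, rest => by
    have ih := length_loops_sortMoves_append_le P (Q.erase p) (n + 1) (toFront p n Q ++ rest)
    have h1 := length_loops_toFront_append_le p Q n rest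
    have h2 : (Q.erase p).length ≤ Q.length := (List.erase_sublist).length_le
    have h3 : P.length * (Q.erase p).length ≤ P.length * Q.length := Nat.mul_le_mul_left _ h2
    rw [sortMoves, List.append_assoc, List.length_cons, Nat.succ_mul]
    omega

/-- Erasing `γ` from `S ++ γ :: Γ'` for a CONSTANT word `S = c^L` gives `S ++ Γ'` — whether or not `γ = c`. [folklore] -/
theorem erase_replicate_append_cons (c γ : Letter d) (Γ' : List (Letter d)) : ∀ L : ℕ,
    (List.replicate L c ++ γ :: Γ').erase γ = List.replicate L c ++ Γ'
  | 0 => by simp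
  | L + 1 => by
    rw [List.replicate_succ, List.cons_append, List.cons_append]
    by_cases hc : c = γ
    · subst hc
      rw [List.erase_cons_head, List.append_cons, ← List.replicate_succ', List.replicate_succ, List.cons_append]
    · rw [List.erase_cons_tail (by simpa using hc), erase_replicate_append_cons c γ Γ' L]

/-- Sorting a constant word into itself inserts nothing. -/
theorem loops_sortMoves_replicate_self (c : Letter d) : ∀ (L n : ℕ) (rest : List (Move d)),
    loops (sortMoves n (List.replicate L c) (List.replicate L c) ++ rest) = loops rest
  | 0, _, _ => by simp [sortMoves]
  | L + 1, n, rest => by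
    rw [List.replicate_succ, sortMoves, List.erase_cons_head, List.append_assoc, loops_sortMoves_replicate_self c L (n + 1), toFront,
      if_pos rfl, List.nil_append]

/-- **THE COMMUTING INSTANCE**: sorting `S ++ Γ` into `Γ ++ S` for a constant word `S = c^L` (a straight segment) inserts at most `L·|Γ|`
plaquettes — each letter of `Γ` is carried past the `L` letters of `S` once (and past none when it is parallel to `c`). [folklore] -/
theorem length_loops_sortMoves_comm_replicate_le (c : Letter d) (L : ℕ) : ∀ (Γ : List (Letter d)) (n : ℕ) (rest : List (Move d)),
    (loops (sortMoves n (Γ ++ List.replicate L c) (List.replicate L c ++ Γ) ++ rest)).length ≤ (loops rest).length + L * Γ.length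
  | [], n, rest => by rw [List.nil_append, List.append_nil, loops_sortMoves_replicate_self]; simp
  | γ :: Γ, n, rest => by
    have ih := length_loops_sortMoves_comm_replicate_le c L Γ (n + 1) (toFront γ n (List.replicate L c ++ γ :: Γ) ++ rest)
    have h1 := length_loops_toFront_append_le_of_eq γ (List.replicate L c) Γ n rest
    rw [List.length_replicate] at h1
    rw [List.cons_append, sortMoves, erase_replicate_append_cons, List.append_assoc, List.length_cons, Nat.mul_succ]
    omega

end Sorting

/-! ## §3 The backtrack tower and the path-pair script -/

section PathPair

/-- DATA.  `towerMoves n Q`: nested backtracks writing `Q ++ Q⁻¹` after a prefix of length `n` (head applied last: the outermost letter first). -/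
def towerMoves : ℕ → List (Letter d) → List (Move d)
  | _, [] => []
  | n, q :: Q => towerMoves (n + 1) Q ++ [Move.backtrack n q]

/-- **THE TOWER BUILDS `Q Q⁻¹`**: `build rest = X ++ Z`, `|X| = n` ⟹ `build (towerMoves n Q ++ rest) = X ++ Q ++ revWord Q ++ Z`. [folklore] -/
theorem build_towerMoves_append : ∀ (Q X Z : List (Letter d)) {n : ℕ}, X.length = n → ∀ rest : List (Move d),
    build rest = X ++ Z → build (towerMoves n Q ++ rest) = X ++ Q ++ revWord Q ++ Z
  | [], X, Z, _, _, rest, hrest => by simpa [towerMoves] using hrest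
  | q :: Q, X, Z, n, hX, rest, hrest => by
    have h1 : build (Move.backtrack n q :: rest) = (X ++ [q]) ++ (q.rev :: Z) := by
      rw [build_backtrack_of_eq q hrest hX]; simp
    have ih := build_towerMoves_append Q (X ++ [q]) (q.rev :: Z) (n := n + 1) (by simp [hX]) _ h1
    rw [towerMoves, List.append_assoc, List.singleton_append, ih, revWord_cons]
    simp

/-- The tower inserts no word … -/
theorem loops_towerMoves_append : ∀ (Q : List (Letter d)) (n : ℕ) (rest : List (Move d)), loops (towerMoves n Q ++ rest) = loops rest
  | [], _, _ => by simp [towerMoves]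
  | q :: Q, n, rest => by
    rw [towerMoves, List.append_assoc, List.singleton_append, loops_towerMoves_append Q (n + 1), loops]

/-- … and glues nothing. -/
theorem glued_towerMoves_append (x : Site d) : ∀ (Q : List (Letter d)) (n : ℕ) (rest : List (Move d)),
    glued x (towerMoves n Q ++ rest) = glued x rest
  | [], _, _ => by simp [towerMoves]
  | q :: Q, n, rest => by
    rw [towerMoves, List.append_assoc, List.singleton_append, glued_towerMoves_append x Q (n + 1), glued]

/-- DATA.  **THE PATH-PAIR SCRIPT**: the tower `Q Q⁻¹`, then `Q` sorted into `P` — builds the loop «out along `P`, back along `Q`». -/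
def pathPairScript (P Q : List (Letter d)) : List (Move d) := sortMoves 0 P Q ++ towerMoves 0 Q

/-- **THE PATH-PAIR SCRIPT BUILDS `P ++ Q⁻¹`** for `Q` a permutation of `P`. [folklore] -/
theorem build_pathPairScript {P Q : List (Letter d)} (h : Q.Perm P) : build (pathPairScript P Q) = P ++ revWord Q := by
  have h1 : build (towerMoves 0 Q ++ ([] : List (Move d))) = [] ++ Q ++ revWord Q ++ [] :=
    build_towerMoves_append Q [] [] (n := 0) rfl [] rfl
  have h2 := build_sortMoves_append P Q [] (revWord Q ++ []) (n := 0) rfl _ (by rw [h1]; simp) h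
  rw [pathPairScript, ← List.append_nil (sortMoves 0 P Q ++ towerMoves 0 Q), List.append_assoc, h2]
  simp

/-- Every word inserted by the path-pair script is a non-degenerate plaquette contour `plaqWord a b`, `a ≠ b`. [folklore] -/
theorem exists_eq_plaqWord_of_mem_loops_pathPairScript (P Q : List (Letter d)) {σ : List (Letter d)}
    (hσ : σ ∈ loops (pathPairScript P Q)) : ∃ a b : Fin d, a ≠ b ∧ σ = plaqWord a b := by
  rw [pathPairScript] at hσ
  rcases mem_loops_sortMoves_append P Q 0 _ hσ with h | h
  · rw [← List.append_nil (towerMoves 0 Q), loops_towerMoves_append] at h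
    simp [loops] at h
  · exact h

/-- **AT MOST `|P|·|Q|` PLAQUETTES.** [folklore] -/
theorem length_loops_pathPairScript_le (P Q : List (Letter d)) : (loops (pathPairScript P Q)).length ≤ P.length * Q.length := by
  have h := length_loops_sortMoves_append_le P Q 0 (towerMoves 0 Q)
  rw [← List.append_nil (towerMoves 0 Q), loops_towerMoves_append] at h
  rw [pathPairScript, ← List.append_nil (sortMoves 0 P Q ++ towerMoves 0 Q), List.append_assoc]
  simpa [loops] using h

/-- **AT MOST `L·|Γ|` PLAQUETTES FOR `Γ S` AGAINST `S Γ`**, `S = c^L` a straight segment. [folklore] -/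
theorem length_loops_pathPairScript_comm_replicate_le (Γ : List (Letter d)) (c : Letter d) (L : ℕ) :
    (loops (pathPairScript (Γ ++ List.replicate L c) (List.replicate L c ++ Γ))).length ≤ L * Γ.length := by
  have h := length_loops_sortMoves_comm_replicate_le c L Γ 0 (towerMoves 0 (List.replicate L c ++ Γ))
  rw [← List.append_nil (towerMoves 0 _), loops_towerMoves_append] at h
  rw [pathPairScript, ← List.append_nil (sortMoves 0 _ _ ++ towerMoves 0 _), List.append_assoc]
  simpa [loops] using h

end PathPair

/-! ## §4 (NAS): two paths with the same letters have close transports -/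

section NAS

variable {G : Type*} [GaugeGroup G] (V : Site d → Fin d → G)

/-- Words with the same letters have the same displacement. -/
theorem disp_eq_of_perm {P Q : List (Letter d)} (h : Q.Perm P) : disp Q = disp P :=
  (h.map Letter.vec).sum_eq

/-- **(NAS) FOR A PATH PAIR**: for `Q` a permutation of `P`, `dist1 (U(P; x) · U(Q; x)⁻¹) ≤ Σ_{(y, ∂p) glued} dist1 U(∂p; y)` — the transports
along two lattice paths with the same letters (hence the same endpoints) differ by the holonomy of a disc tiled by the glued plaquettes
(`NonAbelianStokesDisc.dist1_hol_build_le_sum` ∘ `build_pathPairScript`). [folklore] -/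
theorem dist1_hol_mul_inv_le_sum (x : Site d) {P Q : List (Letter d)} (h : Q.Perm P) :
    dist1 (hol V x P * (hol V x Q)⁻¹) ≤ ((glued x (pathPairScript P Q)).map fun q => dist1 (hol V q.1 q.2)).sum := by
  have hb := dist1_hol_build_le_sum V x (pathPairScript P Q) (fun σ hσ => by
    obtain ⟨a, b, -, rfl⟩ := exists_eq_plaqWord_of_mem_loops_pathPairScript P Q hσ
    exact disp_plaqWord a b)
  rwa [build_pathPairScript h, hol_append, ← disp_eq_of_perm h, hol_revWord] at hb

/-- Under a plaquette letter `dist1 U(∂p_{ab}(y)) ≤ ε` (`a ≠ b`, `ε ≥ 0`) the glued sum of a path-pair script is at most (number of glued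
plaquettes) `· ε`, hence `≤ N · ε` for any bound `N` on that number. [folklore] -/
theorem sum_glued_pathPairScript_le (x : Site d) (P Q : List (Letter d)) {ε : ℝ} (hε : 0 ≤ ε)
    (hpl : ∀ (y : Site d) (a b : Fin d), a ≠ b → dist1 (hol V y (plaqWord a b)) ≤ ε) {N : ℕ}
    (hN : (loops (pathPairScript P Q)).length ≤ N) :
    ((glued x (pathPairScript P Q)).map fun q => dist1 (hol V q.1 q.2)).sum ≤ (N : ℝ) * ε := by
  have heach : ∀ q ∈ glued x (pathPairScript P Q), dist1 (hol V q.1 q.2) ≤ ε := by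
    intro q hq
    have hq' : q.2 ∈ loops (pathPairScript P Q) := by
      rw [← map_snd_glued x]; exact List.mem_map.mpr ⟨q, hq, rfl⟩
    obtain ⟨a, b, hab, hq2⟩ := exists_eq_plaqWord_of_mem_loops_pathPairScript P Q hq'
    rw [hq2]; exact hpl _ _ _ hab
  have hlen : (glued x (pathPairScript P Q)).length ≤ N := by
    rw [← List.length_map (f := Prod.snd), map_snd_glued]; exact hN
  calc ((glued x (pathPairScript P Q)).map fun q => dist1 (hol V q.1 q.2)).sum
      ≤ ((glued x (pathPairScript P Q)).map fun _ => ε).sum := List.sum_le_sum heach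
    _ = ((glued x (pathPairScript P Q)).length : ℝ) * ε := by
      rw [List.map_const', List.sum_replicate, nsmul_eq_mul]
    _ ≤ (N : ℝ) * ε := mul_le_mul_of_nonneg_right (by exact_mod_cast hlen) hε

/-- **THE PLAQUETTE-LETTER FORM**: if every non-degenerate plaquette holonomy satisfies `dist1 U(∂p_{ab}(y)) ≤ ε` (`ε ≥ 0`), then for `Q` a
permutation of `P`: `dist1 (U(P; x) U(Q; x)⁻¹) ≤ |P|·|Q|·ε`. [folklore] -/
theorem dist1_hol_mul_inv_le_of_plaquette_letter (x : Site d) {P Q : List (Letter d)} (h : Q.Perm P) {ε : ℝ} (hε : 0 ≤ ε)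
    (hpl : ∀ (y : Site d) (a b : Fin d), a ≠ b → dist1 (hol V y (plaqWord a b)) ≤ ε) :
    dist1 (hol V x P * (hol V x Q)⁻¹) ≤ ((P.length * Q.length : ℕ) : ℝ) * ε :=
  (dist1_hol_mul_inv_le_sum V x h).trans (sum_glued_pathPairScript_le V x P Q hε hpl (length_loops_pathPairScript_le P Q))

/-- **THE COMMUTING INSTANCE**: carrying a word `Γ` past a straight segment `S = c^L` costs at most `L·|Γ|` plaquettes:
`dist1 (U(Γ S; x) U(S Γ; x)⁻¹) ≤ L·|Γ|·ε`. [folklore] -/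
theorem dist1_hol_comm_replicate_le (x : Site d) (Γ : List (Letter d)) (c : Letter d) (L : ℕ) {ε : ℝ} (hε : 0 ≤ ε)
    (hpl : ∀ (y : Site d) (a b : Fin d), a ≠ b → dist1 (hol V y (plaqWord a b)) ≤ ε) :
    dist1 (hol V x (Γ ++ List.replicate L c) * (hol V x (List.replicate L c ++ Γ))⁻¹) ≤ ((L * Γ.length : ℕ) : ℝ) * ε :=
  (dist1_hol_mul_inv_le_sum V x List.perm_append_comm).trans
    (sum_glued_pathPairScript_le V x _ _ hε hpl (length_loops_pathPairScript_comm_replicate_le Γ c L))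

/-- **THE CELL'S PAIR** (Lemma CS (ii)'s two transports, in `B7Prop1Explicit`'s words): the tree contour `treeWord r` followed by the straight
segment `seg κ L`, against the segment followed by the (translated) tree contour — the same letters in another order —
`dist1 (U(treeWord r · seg κ L; x) · U(seg κ L · treeWord r; x)⁻¹) ≤ L · l1(r) · ε`: one plaquette per (segment bond, contour bond) pair. [folklore] -/
theorem dist1_hol_treeWord_seg_comm_le (x r : Site d) (κ : Fin d) (L : ℕ) {ε : ℝ} (hε : 0 ≤ ε)
    (hpl : ∀ (y : Site d) (a b : Fin d), a ≠ b → dist1 (hol V y (plaqWord a b)) ≤ ε) :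
    dist1 (hol V x (treeWord r ++ seg κ L) * (hol V x (seg κ L ++ treeWord r))⁻¹) ≤ ((L * l1 r : ℕ) : ℝ) * ε := by
  rw [seg_natCast, ← length_treeWord r]
  exact dist1_hol_comm_replicate_le V x (treeWord r) (κ, true) L hε hpl

end NAS

/-! ## §5 Toys -/

section Toys

/-- The smallest path pair: `a⁺b⁺` against `b⁺a⁺` — the script builds the plaquette contour `a⁺ b⁺ a⁻ b⁻ = ∂p_{ab}` itself … -/
example (a b : Fin d) :
    build (pathPairScript [((a, true) : Letter d), (b, true)] [(b, true), (a, true)]) = plaqWord a b := by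
  rw [build_pathPairScript (List.Perm.swap (a, true) (b, true) [])]
  simp [revWord, plaqWord, Letter.rev]

/-- … gluing exactly one plaquette when `a ≠ b` (and none when `a = b`: the word is then a backtrack tower). -/
example (a b : Fin d) (hab : a ≠ b) :
    (loops (pathPairScript [((a, true) : Letter d), (b, true)] [(b, true), (a, true)])).length = 1 := by
  simp [pathPairScript, sortMoves, toFront, towerMoves, loops_swapMoves_append, loops, Ne.symm hab]

example (a : Fin d) : loops (pathPairScript [((a, true) : Letter d), (a, true)] [(a, true), (a, true)]) = [] := by
  simp [pathPairScript, sortMoves, toFront, towerMoves, loops]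

end Toys

end Summit.QuantumFields.BalabanUV.T4Continuum.NE7b.NonAbelianStokesPathPair
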